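import Literature.MathematicalPhysics.QuantumFieldTheory.Balaban1983to89.B9Thm315Whole
import Literature.MathematicalPhysics.QuantumFieldTheory.Balaban1983to89.B9Thm314WholePinGeometry
import Literature.MathematicalPhysics.QuantumFieldTheory.Balaban1983to89.Node00.OpsYOfLetters

/-!
# `Balaban1983to89.B9Thm315WholeBlocks` — [B9] Theorem 3.15 (p. 432): row 24's READING RE-INDEXED BY BLOCKS (a many-to-one placing
# `π : Site → P` with an index pseudo-distance), and its INSTANCE at NODE 00's layer of letters (`Node00.operatorLayerYOfLetters`)

T. Bałaban, *Propagators for lattice gauge theories in a background field*, Commun. Math. Phys. **99** (1985) 389–434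
[`Balaban1985BackgroundPropagators`, "B9"].

statement-level skeleton of published theorems with citation tags; proofs where landed; nothing here is a claim about the Yang–Mills mass gap

THE PRINTED LOCUS (verbatim, p. 432): *"For Mα₀ sufficiently small the propagator C^{(k)}(Λ) is given by the formula (3.185), and satisfies
the bound |C^{(k)}(Λ; y, y′)| ≤ B₀e^{−δ₀|y−y′|}, y, y′ ∈ Λ (3.187) with the constants B₀, δ₀ depending on d and L only."*; (3.185):
*"C^{(k)}(Λ) = (I + D̄μ)QG̃₂Q*(I + μ*D̄*)"*; p. 390: *"|·| is the block norm"* (the entries of these operators are End(𝔤)-valued).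

THE POINT.  `B9Thm315Whole` (seat n06-m g0, row 24) reads the leaf's real kernel `Ck` against the (3.185) letters through a placing
`e : P → Site` of the letters' index INTO the sites with a covering clause (`Reads315.cover`: every site of Λ is some `e p`).  At NODE 00's
layer of letters (`Node00.OpsYOfLetters`, def-Y) the kernel `(ops x).Ck` is `siteKernelOfOp … 𝔏.Ck β β`: it reads the letter
`𝔏.Ck U : (𝔅 → 𝔸) →ₗ[ℂ] (𝔅 → 𝔸)` at the BLOCKS `β y`, `β y′` of the two bonds — a MANY-TO-ONE map from sites to the natural index 𝔅.  A
bond-indexed `Ops315.C` over-counts blocks in the identity C = E·S·F; a block-indexed one cannot satisfy `cover`.  THIS FILE re-indexes the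
reading by blocks and instantiates it:
* §1 (generic) `Ops315B` (the four letters C, E, S, F of (3.185) as `P × P` block matrices over a real normed ring `𝔸′`), `GivenBy3185B`
  (C = E·S·F), `HasRWExpCB` (‖S(p, q)‖ ≤ B₁e^{−δρ(p,q)} along an INDEX pseudo-distance `ρ`), `Reads315B` (|Ck(U; y, y′)| ≤ K‖C(U; π y, π y′)‖
  along a placing `π : Site → P`), `Static315B` (ρ a pseudo-distance DOMINATING |y − y′| through π on Λ; the locality of E, the adjoint relation
  of F — (3.169)); `bound3187B`, ★ `thm315FullPrinted_of_3185B` (the whole printed leaf `B9.Thm315FullPrinted` at these pins, same rate).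
* §2 (generic) THE BLOCKS OF A ℂ-LINEAR MAP on `X → 𝔸` (`X` finite, `𝔸` a finite-dimensional normed ℂ-algebra — the record's
  `Matrix (Fin N) (Fin N) ℂ`): `blockCLM T z w : 𝔸 →L[ℂ] 𝔸` (a ↦ (T(δ_w ⊗ a))(z)), `blockMat T : Matrix X X (𝔸 →L[ℂ] 𝔸)`, the reading
  inequality `iSup_ball_le_norm_blockCLM` (sup over the closed unit ball ≤ operator norm), and the supplier's bridge `blockMat_comp`
  (blocks of a composition = the product of the block matrices — so an OPERATOR factorisation 𝒞 = ℰ ∘ 𝒮 ∘ ℱ gives `GivenBy3185B` exactly).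
* §3 (instance) at a member `x` of Stage 3′(Y): `kLabB` ∕ `blockDistY` (the |·|-distance of (3.187) on 𝔅 through the k-labels;
  `unitDistY_eq_blockDistY`: def-Y's `unitDistY x y y′` IS `blockDistY x (β y) (β y′)`; `isPseudoDist_blockDistY`), `ops315BOfLetters`
  (C := the blocks of the letter `𝔏.Ck`), ★ `reads315B_layerOfLetters` (the READING PROVED, K = 1, for EVERY letter family), ★
  `thm315_layerOfLetters_of_blocks` — row 24's binder shape at `ops := fun x => operatorLayerYOfLetters 𝔸 G x (𝔏 x) (𝔈 x)` from: the
  letters E, S, F per member, the locality data (range ∕ row mass ∕ adjoint), the pinned prefix ((3.185) as a block identity and the summed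
  random-walk bound of QG̃₂Q* at rate δ₁, under (3.35)–(3.36)) and the two slot implications into `𝔈`'s free predicate fields;
  §4 ★ `thm315_opsYOfLetters_of_blocks` — the same at the record's carriers (`opsYOfLetters N θ M⋆ 𝔏 𝔈`: the certificate binder `t315` verbatim).

HONEST SCOPE.  Count-neutral kernel bookkeeping: the reading clause of row 24 becomes a theorem at the layer of letters; (3.185) itself, the
random-walk bound of QG̃₂Q* and the locality constants r, m of (3.169) stay HYPOTHESES of printed shape (GAPS G-B9-09∕10∕17), now about block
matrices over 𝔅 with End(𝔸)-entries; nothing of print is asserted; NOT a node discharge, NOT summit progress; one finite lattice programme;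
nothing continuum, nothing about the mass gap.  Cell `pub-ymgap` (D-0062), node N06 [B9], N06-ASSIGNMENT v1 row 24 (successor file of bundle
F8), seat `pub-ymgap-dag-n06-m` (g2), 2026-08-26.
-/

noncomputable section

namespace Literature.MathematicalPhysics.QuantumFieldTheory.Balaban1983to89.B9Thm315WholeBlocks

open Finset
open B4Sect5Torus (IsPseudoDist)
open B9Eq3187Op (op_decay_3187)
open B9Thm315Whole (thm315FullPrinted_of_imp)
open scoped Matrix

/-! ## §1 The block-indexed letters, pins, reading and locality; (3.185) ⇒ (3.187) at the pins -/

section Generic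

variable {g : B9.Geometry} {B : B9.Backgrounds} {𝔸' : Type} [NormedRing 𝔸'] {P : Type}

/-- **THE FOUR LETTERS OF (3.185) AS BLOCK MATRICES** over an index `P` (the blocks 𝔅, or the coordinates of Λ) with entries in a real
normed ring `𝔸′` (= End 𝔤, p. 390's block norm): `C U` = C^{(k)}(Λ), `E U` = I + D̄μ, `S U` = QG̃₂Q*, `F U` = I + μ*D̄*.  A PARAMETER RECORD;
nothing constructed or asserted. [cite: Balaban1985BackgroundPropagators, (3.185) p.432 + (3.169) p.430] -/
structure Ops315B (B : B9.Backgrounds) (𝔸' : Type) (P : Type) where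
  C : B.Cfg → Matrix P P 𝔸'
  E : B.Cfg → Matrix P P 𝔸'
  S : B.Cfg → Matrix P P 𝔸'
  F : B.Cfg → Matrix P P 𝔸'

variable [Fintype P]

/-- **THE PIN OF «is given by the formula (3.185)»** as a block identity: C = E·S·F at U. [cite: Balaban1985BackgroundPropagators, Thm 3.15 (3.185) p.432] -/
def GivenBy3185B (𝔬 : Ops315B B 𝔸' P) (U : B.Cfg) : Prop :=
  𝔬.C U = 𝔬.E U * 𝔬.S U * 𝔬.F U

omit [Fintype P] in
/-- **THE PIN OF THE SUMMED RANDOM-WALK BOUND of QG̃₂Q*** along an index pseudo-distance `ρ`: ‖S(U; p, q)‖ ≤ B₁e^{−δρ(p,q)}.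
[cite: Balaban1985BackgroundPropagators, Thm 3.15 p.432 («has a convergent random walk expansion»)] -/
def HasRWExpCB (𝔬 : Ops315B B 𝔸' P) (ρ : P → P → ℝ) (B₁ : ℝ) (U : B.Cfg) (δ : ℝ) : Prop :=
  ∀ p q, ‖𝔬.S U p q‖ ≤ B₁ * Real.exp (-(δ * ρ p q))

omit [Fintype P] in
/-- **THE READING, MANY-TO-ONE**: the leaf's real kernel entry |C^{(k)}(Λ; y, y′)| is at most K times the block norm of the letter's block
at the places `π y`, `π y′` (π = the block of a site; K = 1 when the entry IS the sup over the unit ball, §3). [cite: Balaban1985BackgroundPropagators, (3.187) p.432 + p.390] -/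
structure Reads315B (𝔬 : Ops315B B 𝔸' P) (Ck : B9.SiteKernel g B) (π : g.Site → P) (K : ℝ) : Prop where
  dom : ∀ (U : B.Cfg) (y y' : g.Site), |Ck.ker U y y'| ≤ K * ‖𝔬.C U (π y) (π y')‖

/-- **THE LOCALITY DATA along the index distance**: `ρ` is a pseudo-distance on the index that DOMINATES |y − y′| on Λ through the placing
(at NODE 00's blocks with equality, §3); E(U) has range ≤ r and row mass ≤ m, ‖F(U; q, p)‖ ≤ ‖E(U; p, q)‖ — (3.169), uniformly in U.
A hypothesis schema. [cite: Balaban1985BackgroundPropagators, (3.169) p.430 + (3.185) p.432] -/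
structure Static315B (𝔬 : Ops315B B 𝔸' P) (ρ : P → P → ℝ) (unitDist : g.Site → g.Site → ℝ) (π : g.Site → P)
    (inΛ : g.Site → Prop) (r m : ℝ) : Prop where
  pdist : IsPseudoDist ρ
  cmp : ∀ y y', inΛ y → inΛ y' → unitDist y y' ≤ ρ (π y) (π y')
  range : ∀ (U : B.Cfg) (p q : P), 𝔬.E U p q ≠ 0 → ρ p q ≤ r
  rowMass : ∀ (U : B.Cfg) (p : P), ∑ q, ‖𝔬.E U p q‖ ≤ m
  adj : ∀ (U : B.Cfg) (q p : P), ‖𝔬.F U q p‖ ≤ ‖𝔬.E U p q‖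

/-- **(3.185) ⇒ (3.187) AT ONE CONFIGURATION, block-indexed** (p. 432: *"The formula (3.185) implies immediately bounds and an exponential
decay"*): |C^{(k)}(Λ; y, y′)| ≤ K·B₁e^{2δr}m²·e^{−δ|y − y′|} on Λ — `B9Eq3187Op.op_decay_3187` along `ρ`, then `cmp`. [cite: Balaban1985BackgroundPropagators, Thm 3.15 (3.185)–(3.187) p.432] -/
theorem bound3187B {𝔬 : Ops315B B 𝔸' P} {Ck : B9.SiteKernel g B} {ρ : P → P → ℝ} {unitDist : g.Site → g.Site → ℝ}
    {π : g.Site → P} {inΛ : g.Site → Prop} {K r m B₁ δ : ℝ} {U : B.Cfg} (hK : 0 ≤ K) (hB₁ : 0 ≤ B₁) (hδ : 0 ≤ δ)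
    (hR : Reads315B 𝔬 Ck π K) (hS : Static315B 𝔬 ρ unitDist π inΛ r m) (h85 : GivenBy3185B 𝔬 U) (hRW : HasRWExpCB 𝔬 ρ B₁ U δ) :
    ∀ y y', inΛ y → inΛ y' →
      |Ck.ker U y y'| ≤ K * (B₁ * Real.exp (2 * δ * r) * m * m) * Real.exp (-(δ * unitDist y y')) := by
  intro y y' hy hy'
  have hop := op_decay_3187 ρ hS.pdist (𝔬.E U) (𝔬.S U) (𝔬.F U) hB₁ hδ hRW (hS.range U) (hS.rowMass U) (hS.adj U) (π y) (π y')
  have h85' : 𝔬.C U = 𝔬.E U * 𝔬.S U * 𝔬.F U := h85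
  have hexp : Real.exp (-(δ * ρ (π y) (π y'))) ≤ Real.exp (-(δ * unitDist y y')) :=
    Real.exp_le_exp.2 (neg_le_neg (mul_le_mul_of_nonneg_left (hS.cmp y y' hy hy') hδ))
  have hpos : 0 ≤ K * (B₁ * Real.exp (2 * δ * r) * m * m) := by
    have hm : 0 ≤ m := le_trans (Finset.sum_nonneg fun q _ => norm_nonneg _) (hS.rowMass U (π y))
    positivity
  calc |Ck.ker U y y'| ≤ K * ‖𝔬.C U (π y) (π y')‖ := hR.dom U y y'
    _ ≤ K * (B₁ * Real.exp (2 * δ * r) * m * m * Real.exp (-(δ * ρ (π y) (π y')))) := by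
        rw [h85']; exact mul_le_mul_of_nonneg_left hop hK
    _ = K * (B₁ * Real.exp (2 * δ * r) * m * m) * Real.exp (-(δ * ρ (π y) (π y'))) := by ring
    _ ≤ K * (B₁ * Real.exp (2 * δ * r) * m * m) * Real.exp (-(δ * unitDist y y')) := mul_le_mul_of_nonneg_left hexp hpos

end Generic

section Family

variable {I : Type} {c35 : ℝ} {geo : I → B9.Geometry} {bg : I → B9.Backgrounds}
  {Ck : ∀ i, B9.SiteKernel (geo i) (bg i)} {inΛ : ∀ i, (geo i).Site → Prop}
  {unitDist : ∀ i, (geo i).Site → (geo i).Site → ℝ} {𝔸' : Type} [NormedRing 𝔸'] {P : I → Type} [∀ i, Fintype (P i)]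

/-- ★ **THEOREM 3.15 AS THE WHOLE PRINTED LEAF `B9.Thm315FullPrinted`, AT THE BLOCK-INDEXED PINS**: the slots SET to `GivenBy3185B (𝔬 i)`
and `HasRWExpCB (𝔬 i) (ρ i) B₁`; inputs displayed — per member the reading `Reads315B` along the placing `π i` (constant K) and the locality
`Static315B` (r, m uniform, «depending on d and L only»), and under the printed prefix (0 < α₀, Mα₀ ≤ a₀, U in (3.35) and (3.36)) the two
pinned clauses.  Output: δ₀ = δ₁ (same rate), a₀, B₀ = K·B₁e^{2δ₁r}m².  Nothing of print asserted; NOT a node discharge.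
[cite: Balaban1985BackgroundPropagators, Thm 3.15 (3.185)–(3.187) p.432 + (3.169) p.430] -/
theorem thm315FullPrinted_of_3185B (𝔬 : ∀ i, Ops315B (bg i) 𝔸' (P i)) (ρ : ∀ i, P i → P i → ℝ) (π : ∀ i, (geo i).Site → P i)
    {K r m a₀ δ₁ B₁ : ℝ} (hK : 0 < K) (hm : 0 < m) (ha₀ : 0 < a₀) (hδ₁ : 0 < δ₁) (hB₁ : 0 < B₁)
    (hR : ∀ i, Reads315B (𝔬 i) (Ck i) (π i) K) (hS : ∀ i, Static315B (𝔬 i) (ρ i) (unitDist i) (π i) (inΛ i) r m)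
    (h : ∀ i : I, ∀ α₀ : ℝ, 0 < α₀ → (geo i).M * α₀ ≤ a₀ →
      ∀ U : (bg i).Cfg, (bg i).Reg335 c35 α₀ U → (bg i).Reg336 c35 α₀ U →
        GivenBy3185B (𝔬 i) U ∧ HasRWExpCB (𝔬 i) (ρ i) B₁ U δ₁) :
    B9.Thm315FullPrinted c35 geo bg Ck inΛ unitDist (fun i => GivenBy3185B (𝔬 i))
      (fun i U δ => HasRWExpCB (𝔬 i) (ρ i) B₁ U δ) := by
  refine ⟨δ₁, a₀, K * (B₁ * Real.exp (2 * δ₁ * r) * m * m), hδ₁, ha₀,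
    mul_pos hK (mul_pos (mul_pos (mul_pos hB₁ (Real.exp_pos _)) hm) hm), fun i α₀ hα hMa U hU hU' => ?_⟩
  obtain ⟨h85, hRW⟩ := h i α₀ hα hMa U hU hU'
  exact ⟨h85, hRW, bound3187B hK.le hB₁.le hδ₁.le (hR i) (hS i) h85 hRW⟩

end Family

/-! ## §2 The blocks of a ℂ-linear map on `X → 𝔸` (X finite, 𝔸 finite-dimensional) -/

section Blocks

open Node00 (deltaY BallY ballY_nonempty)

variable {𝔸 : Type} [NormedRing 𝔸] {X : Type}

/-- `δ_w ⊗ (a + b) = δ_w ⊗ a + δ_w ⊗ b`. [cite: Balaban1985BackgroundPropagators, (3.187) p.432 (kernel entries; bookkeeping)] -/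
theorem deltaY_add (w : X) (a b : 𝔸) : deltaY w (a + b) = deltaY w a + deltaY w b := by
  funext z
  by_cases h : z = w <;> simp [deltaY, h]

/-- `δ_w ⊗ (c • a) = c • (δ_w ⊗ a)`. [cite: Balaban1985BackgroundPropagators, (3.187) p.432 (kernel entries; bookkeeping)] -/
theorem deltaY_smul [NormedAlgebra ℂ 𝔸] (w : X) (c : ℂ) (a : 𝔸) : deltaY w (c • a) = c • deltaY w a := by
  funext z
  by_cases h : z = w <;> simp [deltaY, h]

/-- a function on the finite index set is the sum of its `δ_w ⊗ f(w)`. [cite: Balaban1985BackgroundPropagators, (3.187) p.432 (kernel entries; bookkeeping)] -/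
theorem sum_deltaY [Fintype X] (f : X → 𝔸) : ∑ w, deltaY w (f w) = f := by
  classical
  funext z
  rw [Finset.sum_apply]
  simp only [deltaY]
  rw [Finset.sum_ite_eq]
  simp

variable [NormedAlgebra ℂ 𝔸]

/-- **THE (z, w)-BLOCK OF A ℂ-LINEAR MAP** `T` on `X → 𝔸`: the endomorphism a ↦ (T(δ_w ⊗ a))(z) of `𝔸`, as a linear map.
[cite: Balaban1985BackgroundPropagators, p.390 («|·| is the block norm»), dictionary] -/
def blockLM (T : (X → 𝔸) →ₗ[ℂ] (X → 𝔸)) (z w : X) : 𝔸 →ₗ[ℂ] 𝔸 where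
  toFun a := T (deltaY w a) z
  map_add' a b := by rw [deltaY_add, map_add]; rfl
  map_smul' c a := by rw [deltaY_smul, map_smul]; rfl

variable [FiniteDimensional ℂ 𝔸]

/-- **THE (z, w)-BLOCK AS A BOUNDED OPERATOR** (finite dimension), an element of the normed ring `𝔸 →L[ℂ] 𝔸` (p. 390's block norm = its
operator norm). [cite: Balaban1985BackgroundPropagators, p.390 («|·| is the block norm»), dictionary] -/
def blockCLM (T : (X → 𝔸) →ₗ[ℂ] (X → 𝔸)) (z w : X) : 𝔸 →L[ℂ] 𝔸 :=
  LinearMap.toContinuousLinearMap (blockLM T z w)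

/-- the block, evaluated. [cite: Balaban1985BackgroundPropagators, p.390, dictionary] -/
@[simp] theorem blockCLM_apply (T : (X → 𝔸) →ₗ[ℂ] (X → 𝔸)) (z w : X) (a : 𝔸) : blockCLM T z w a = T (deltaY w a) z := rfl

/-- **THE BLOCK MATRIX** of `T` over the index `X`, entries in `𝔸 →L[ℂ] 𝔸`. [cite: Balaban1985BackgroundPropagators, p.390, dictionary] -/
def blockMat (T : (X → 𝔸) →ₗ[ℂ] (X → 𝔸)) : Matrix X X (𝔸 →L[ℂ] 𝔸) :=
  Matrix.of fun z w => blockCLM T z w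

/-- the block matrix, evaluated. [cite: Balaban1985BackgroundPropagators, p.390, dictionary] -/
@[simp] theorem blockMat_apply (T : (X → 𝔸) →ₗ[ℂ] (X → 𝔸)) (z w : X) : blockMat T z w = blockCLM T z w := rfl

/-- **THE READING INEQUALITY**: the sup over the closed unit ball of `‖(T(δ_w ⊗ E))(z)‖` (def-Y's `siteKernelOfOp` entry) is at most the
operator norm of the block — and it is nonnegative, so its absolute value is, too. [cite: Balaban1985BackgroundPropagators, (3.187) p.432 + p.390] -/
theorem abs_iSup_ball_le_norm_blockCLM [CompleteSpace 𝔸] (T : (X → 𝔸) →ₗ[ℂ] (X → 𝔸)) (z w : X) :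
    |⨆ E : BallY 𝔸, ‖T (deltaY w (E : 𝔸)) z‖| ≤ ‖blockCLM T z w‖ := by
  haveI : Nonempty (BallY 𝔸) := ballY_nonempty
  have hle : ∀ E : BallY 𝔸, ‖T (deltaY w (E : 𝔸)) z‖ ≤ ‖blockCLM T z w‖ := fun E => by
    have hE : ‖(E : 𝔸)‖ ≤ 1 := mem_closedBall_zero_iff.1 E.2
    calc ‖T (deltaY w (E : 𝔸)) z‖ = ‖blockCLM T z w (E : 𝔸)‖ := rfl
      _ ≤ ‖blockCLM T z w‖ * ‖(E : 𝔸)‖ := (blockCLM T z w).le_opNorm _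
      _ ≤ ‖blockCLM T z w‖ * 1 := mul_le_mul_of_nonneg_left hE (norm_nonneg _)
      _ = ‖blockCLM T z w‖ := mul_one _
  rw [abs_of_nonneg (Real.iSup_nonneg fun E => norm_nonneg _)]
  exact ciSup_le hle

/-- **THE SUPPLIER'S BRIDGE — blocks of a composition**: `blockMat (T ∘ S) = blockMat T * blockMat S` (the product in the matrix ring over
`𝔸 →L[ℂ] 𝔸`): an operator factorisation C^{(k)}(Λ) = (I + D̄μ)·QG̃₂Q*·(I + μ*D̄*) gives the block identity `GivenBy3185B` exactly.
[cite: Balaban1985BackgroundPropagators, Thm 3.15 (3.185) p.432 (bookkeeping)] -/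
theorem blockMat_comp [Fintype X] (T S : (X → 𝔸) →ₗ[ℂ] (X → 𝔸)) : blockMat (T ∘ₗ S) = blockMat T * blockMat S := by
  classical
  ext z w a
  have hmul : ∀ v, (blockCLM T z v * blockCLM S v w) a = T (deltaY v (S (deltaY w a) v)) z := fun v => rfl
  rw [Matrix.mul_apply, FunLike.coe_sum, Finset.sum_apply]
  simp only [blockMat_apply, hmul, blockCLM_apply, LinearMap.comp_apply]
  conv_lhs => rw [← sum_deltaY (S (deltaY w a))]
  rw [map_sum, Finset.sum_apply]

/-- a triple composition: `blockMat (E ∘ S ∘ F) = blockMat E * blockMat S * blockMat F`. [cite: Balaban1985BackgroundPropagators, Thm 3.15 (3.185) p.432 (bookkeeping)] -/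
theorem blockMat_comp₃ [Fintype X] (E S F : (X → 𝔸) →ₗ[ℂ] (X → 𝔸)) :
    blockMat (E ∘ₗ S ∘ₗ F) = blockMat E * blockMat S * blockMat F := by
  rw [blockMat_comp, blockMat_comp, mul_assoc]

end Blocks

/-! ## §3 The instance at NODE 00's layer of letters: blocks 𝔅, the placing `β`, the k-label distance, the reading PROVED -/

section Instance

open B4Reflection242 (boxDom blk)
open B6Geom246MultiLevelBox (bset blkOf exists_blkOf_eq)
open B6SectAOperatorsV1 (BondIdx)
open B6GlobalChartV1 (toBox domT)
open B6Ineq2142KLevelV1 (baseSite β)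
open B9Thm314GpFlatTorusGeometry (tdistK)
open B9Thm314QGGQInvFlatTransfer (tdistK_triangle tdistK_comm)
open B9Thm314GpFlatOmegaOff (tdistK_self)
open B9Thm314WholePinGeometry (blk_top_eq_of_blkOf_eq)
open B9PinMembersKLevelV1 (MemberY geo9Y bg9Y)
open B9PinGeometryKLevelV1 (kLab unitDistY inΛY c35Y)
open Node00 (deltaY BallY BlkY CfgY CovLettersY ExpLettersY operatorLayerYOfLetters)

variable {d ℓ : ℕ} {hd : 1 ≤ d + 1} {hL : Odd (ℓ + 1) ∧ 1 < ℓ + 1} {b₀ b₁ : ℝ} {Mstar : ℕ}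

/-- **THE `k`-LABEL OF A BLOCK OF 𝔅** (the point of `T^{(k)}` it determines): the `k`-block label of any of its sites — well defined by
`B9Thm314WholePinGeometry.blk_top_eq_of_blkOf_eq`. [cite: Balaban1985BackgroundPropagators, (3.187) p.432 («y, y′ ∈ Λ» points of T₁^{(k)}; dictionary)] -/
def kLabB (x : MemberY d ℓ hd hL b₀ b₁ Mstar) (s : BlkY x.toKIdx) : Fin (d + 1) → ℤ :=
  blk ((ℓ + 1) ^ x.k) ((exists_blkOf_eq x.D.toDomains s).choose).1

/-- the `k`-label of the block of a site is the site's `k`-label. [cite: Balaban1985BackgroundPropagators, (3.187) p.432, dictionary] -/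
theorem kLabB_blkOf (x : MemberY d ℓ hd hL b₀ b₁ Mstar) (z : ↥(boxDom (B6MultiLevelBoxOperator.N0 ℓ x.Mh x.k x.P'))) :
    kLabB x (blkOf x.D.toDomains z) = blk ((ℓ + 1) ^ x.k) z.1 :=
  blk_top_eq_of_blkOf_eq x.D (exists_blkOf_eq x.D.toDomains (blkOf x.D.toDomains z)).choose_spec

/-- **def-Y's `kLab` FACTORS THROUGH THE BLOCK**: the `k`-label of a bond is the `k`-label of its block `β`. [cite: Balaban1985BackgroundPropagators, (3.187) p.432, dictionary] -/
theorem kLab_eq_kLabB_beta (x : MemberY d ℓ hd hL b₀ b₁ Mstar) (b : BondIdx (domT x.hN x.D x.hk)) :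
    kLab x b = kLabB x (β x.hN x.D x.hk b) :=
  (kLabB_blkOf x _).symm

/-- **|y − y′| ON THE BLOCKS**: p21's `tdistK` at the `k`-labels of two blocks of 𝔅 — the index pseudo-distance `ρ` of §1 at NODE 00.
[cite: Balaban1985BackgroundPropagators, Thm 3.15 (3.187) p.432 («|y − y′|»)] -/
def blockDistY (x : MemberY d ℓ hd hL b₀ b₁ Mstar) (s s' : BlkY x.toKIdx) : ℝ :=
  tdistK (ℓ := ℓ) (Mh := x.Mh) (k := x.k) (P := x.P') (kLabB x s) (kLabB x s')

/-- **def-Y's `unitDistY` IS the block distance of the two bonds' blocks** (equality, for ALL bonds). [cite: Balaban1985BackgroundPropagators, Thm 3.15 (3.187) p.432, dictionary] -/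
theorem unitDistY_eq_blockDistY (x : MemberY d ℓ hd hL b₀ b₁ Mstar) (b b' : BondIdx (domT x.hN x.D x.hk)) :
    unitDistY x b b' = blockDistY x (β x.hN x.D x.hk b) (β x.hN x.D x.hk b') := by
  unfold unitDistY blockDistY
  rw [kLab_eq_kLabB_beta, kLab_eq_kLabB_beta]

/-- the block distance is a pseudo-distance (`tdistK_comm`, `tdistK_self`, `tdistK_triangle`). [cite: Balaban1985BackgroundPropagators, (3.187) p.432, dictionary] -/
theorem isPseudoDist_blockDistY (x : MemberY d ℓ hd hL b₀ b₁ Mstar) : IsPseudoDist (blockDistY x) :=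
  ⟨fun _ _ => tdistK_comm _ _, fun _ => tdistK_self _, fun _ _ _ => tdistK_triangle _ _ _⟩

variable {𝔸 : Type} [NormedRing 𝔸] [NormedAlgebra ℂ 𝔸] [CompleteSpace 𝔸] [FiniteDimensional ℂ 𝔸] {G : Subgroup 𝔸ˣ}

/-- **THE (3.185) LETTERS AT THE LAYER OF LETTERS, BLOCK-INDEXED**: `C U` := the block matrix over 𝔅 of the letter `𝔏.Ck U` (entries in
`𝔸 →L[ℂ] 𝔸`); the three factors `E`, `S`, `F` (I + D̄μ, QG̃₂Q*, I + μ*D̄* as block matrices over 𝔅) are further letters the layer does not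
carry — parameters. [cite: Balaban1985BackgroundPropagators, (3.185) p.432 + (3.187) p.432] -/
def ops315BOfLetters (x : MemberY d ℓ hd hL b₀ b₁ Mstar) (𝔏 : CovLettersY 𝔸 x)
    (E S F : (bg9Y 𝔸 G x).Cfg → Matrix (BlkY x.toKIdx) (BlkY x.toKIdx) (𝔸 →L[ℂ] 𝔸)) :
    Ops315B (bg9Y 𝔸 G x) (𝔸 →L[ℂ] 𝔸) (BlkY x.toKIdx) where
  C := fun U => blockMat (𝔏.Ck U)
  E := E
  S := S
  F := F

/-- ★ **THE READING OF ROW 24, PROVED AT THE LAYER OF LETTERS** (for EVERY covariant letter family `𝔏` and expansion letters `𝔈`): the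
layer's two-point kernel `(operatorLayerYOfLetters 𝔸 G x 𝔏 𝔈).Ck` — def-Y's `siteKernelOfOp … 𝔏.Ck β β`, the sup over the closed unit
ball of `‖(𝔏.Ck U (δ_{β y′} ⊗ E))(β y)‖` — is dominated, with K = 1, by the operator norm of the block of `𝔏.Ck U` at (β y, β y′).
[cite: Balaban1985BackgroundPropagators, Thm 3.15 (3.187) p.432 + p.390 («|·| is the block norm»)] -/
theorem reads315B_layerOfLetters (x : MemberY d ℓ hd hL b₀ b₁ Mstar) (𝔏 : CovLettersY 𝔸 x) (𝔈 : ExpLettersY 𝔸 G x)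
    (E S F : (bg9Y 𝔸 G x).Cfg → Matrix (BlkY x.toKIdx) (BlkY x.toKIdx) (𝔸 →L[ℂ] 𝔸)) :
    Reads315B (ops315BOfLetters x 𝔏 E S F) (operatorLayerYOfLetters 𝔸 G x 𝔏 𝔈).Ck (β x.hN x.D x.hk) 1 := by
  refine ⟨fun U y y' => ?_⟩
  rw [one_mul]
  exact abs_iSup_ball_le_norm_blockCLM (𝔏.Ck U) (β x.hN x.D x.hk y) (β x.hN x.D x.hk y')

/-- **THE SUPPLIER'S BRIDGE AT THE LAYER**: an OPERATOR factorisation of the letter, `𝔏.Ck U = ℰ ∘ 𝒮 ∘ ℱ` on `𝔅 → 𝔸`, gives the pinned block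
identity `GivenBy3185B` with `E`, `S`, `F` := the block matrices of ℰ, 𝒮, ℱ (`blockMat_comp₃`). [cite: Balaban1985BackgroundPropagators, Thm 3.15 (3.185) p.432 (bookkeeping)] -/
theorem givenBy3185B_layerOfLetters_of_comp (x : MemberY d ℓ hd hL b₀ b₁ Mstar) (𝔏 : CovLettersY 𝔸 x)
    (ℰ 𝒮 ℱ : (bg9Y 𝔸 G x).Cfg → (BlkY x.toKIdx → 𝔸) →ₗ[ℂ] (BlkY x.toKIdx → 𝔸)) (U : (bg9Y 𝔸 G x).Cfg)
    (h : 𝔏.Ck U = ℰ U ∘ₗ 𝒮 U ∘ₗ ℱ U) :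
    GivenBy3185B (ops315BOfLetters x 𝔏 (fun U => blockMat (ℰ U)) (fun U => blockMat (𝒮 U)) (fun U => blockMat (ℱ U))) U := by
  show blockMat (𝔏.Ck U) = blockMat (ℰ U) * blockMat (𝒮 U) * blockMat (ℱ U)
  rw [h, blockMat_comp₃]

/-- ★ **ROW 24 AT THE LAYER OF LETTERS, FROM THE BLOCK-INDEXED PINS** — the certificate binder's shape
`B9.Thm315FullPrinted c35Y geo9Y (bg9Y 𝔸 G) (fun x => (ops x).Ck) inΛY unitDistY (fun x => (ops x).GivenBy3185) (fun x => (ops x).HasRWExpC)` at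
`ops x := operatorLayerYOfLetters 𝔸 G x (𝔏 x) (𝔈 x)`, with the READING DISCHARGED (`reads315B_layerOfLetters`) and the distance comparison an
EQUALITY (`unitDistY_eq_blockDistY`).  Displayed: per member the three factor letters `E S F` (block matrices over 𝔅), the locality of (3.169)
(`range`, `rowMass`, `adj` along `blockDistY`; r, m uniform), under the printed prefix the block identity (3.185) and the summed random-walk bound
of QG̃₂Q* at rate δ₁ (GAPS G-B9-09∕10∕17), and the two slot implications into the layer's free predicate slots (met by the CHOICE of `𝔈`).  Nothing
of print asserted; NOT a node discharge. [cite: Balaban1985BackgroundPropagators, Thm 3.15 (3.185)–(3.187) p.432 + (3.169) p.430] -/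
theorem thm315_layerOfLetters_of_blocks (𝔏 : ∀ x : MemberY d ℓ hd hL b₀ b₁ Mstar, CovLettersY 𝔸 x)
    (𝔈 : ∀ x : MemberY d ℓ hd hL b₀ b₁ Mstar, ExpLettersY 𝔸 G x)
    (E S F : ∀ x : MemberY d ℓ hd hL b₀ b₁ Mstar, (bg9Y 𝔸 G x).Cfg → Matrix (BlkY x.toKIdx) (BlkY x.toKIdx) (𝔸 →L[ℂ] 𝔸))
    {r m a₀ δ₁ B₁ : ℝ} (hm : 0 < m) (ha₀ : 0 < a₀) (hδ₁ : 0 < δ₁) (hB₁ : 0 < B₁)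
    (hrange : ∀ (x : MemberY d ℓ hd hL b₀ b₁ Mstar) (U : (bg9Y 𝔸 G x).Cfg) (s s' : BlkY x.toKIdx), E x U s s' ≠ 0 → blockDistY x s s' ≤ r)
    (hrow : ∀ (x : MemberY d ℓ hd hL b₀ b₁ Mstar) (U : (bg9Y 𝔸 G x).Cfg) (s : BlkY x.toKIdx), ∑ s', ‖E x U s s'‖ ≤ m)
    (hadj : ∀ (x : MemberY d ℓ hd hL b₀ b₁ Mstar) (U : (bg9Y 𝔸 G x).Cfg) (s' s : BlkY x.toKIdx), ‖F x U s' s‖ ≤ ‖E x U s s'‖)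
    (h : ∀ (x : MemberY d ℓ hd hL b₀ b₁ Mstar) (α₀ : ℝ), 0 < α₀ → (geo9Y x).M * α₀ ≤ a₀ →
      ∀ U : (bg9Y 𝔸 G x).Cfg, (bg9Y 𝔸 G x).Reg335 c35Y α₀ U → (bg9Y 𝔸 G x).Reg336 c35Y α₀ U →
        GivenBy3185B (ops315BOfLetters x (𝔏 x) (E x) (S x) (F x)) U ∧
          HasRWExpCB (ops315BOfLetters x (𝔏 x) (E x) (S x) (F x)) (blockDistY x) B₁ U δ₁)
    (hG : ∀ (x : MemberY d ℓ hd hL b₀ b₁ Mstar) (U : (bg9Y 𝔸 G x).Cfg),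
      GivenBy3185B (ops315BOfLetters x (𝔏 x) (E x) (S x) (F x)) U → (operatorLayerYOfLetters 𝔸 G x (𝔏 x) (𝔈 x)).GivenBy3185 U)
    (hH : ∀ (x : MemberY d ℓ hd hL b₀ b₁ Mstar) (U : (bg9Y 𝔸 G x).Cfg) (δ' : ℝ),
      HasRWExpCB (ops315BOfLetters x (𝔏 x) (E x) (S x) (F x)) (blockDistY x) B₁ U δ' →
        (operatorLayerYOfLetters 𝔸 G x (𝔏 x) (𝔈 x)).HasRWExpC U δ') :
    B9.Thm315FullPrinted c35Y geo9Y (bg9Y 𝔸 G) (fun x => (operatorLayerYOfLetters 𝔸 G x (𝔏 x) (𝔈 x)).Ck) inΛY unitDistY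
      (fun x => (operatorLayerYOfLetters 𝔸 G x (𝔏 x) (𝔈 x)).GivenBy3185)
      (fun x => (operatorLayerYOfLetters 𝔸 G x (𝔏 x) (𝔈 x)).HasRWExpC) := by
  have hstat : ∀ x : MemberY d ℓ hd hL b₀ b₁ Mstar,
      Static315B (g := geo9Y x) (ops315BOfLetters x (𝔏 x) (E x) (S x) (F x)) (blockDistY x) (unitDistY x) (β x.hN x.D x.hk) (inΛY x) r m :=
    fun x => ⟨isPseudoDist_blockDistY x, fun y y' _ _ => (unitDistY_eq_blockDistY x y y').le, hrange x, hrow x, hadj x⟩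
  have h315 := thm315FullPrinted_of_3185B (c35 := c35Y) (geo := geo9Y) (bg := bg9Y 𝔸 G)
    (Ck := fun x => (operatorLayerYOfLetters 𝔸 G x (𝔏 x) (𝔈 x)).Ck) (inΛ := inΛY) (unitDist := unitDistY)
    (fun x => ops315BOfLetters x (𝔏 x) (E x) (S x) (F x)) (fun x => blockDistY x) (fun x => β x.hN x.D x.hk)
    one_pos hm ha₀ hδ₁ hB₁ (fun x => reads315B_layerOfLetters x (𝔏 x) (𝔈 x) (E x) (S x) (F x)) hstat h
  exact thm315FullPrinted_of_imp hG hH h315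

end Instance


/-! ## §4 At the record's carriers -/

section Record

open B9PinMembersKLevelV1 (MemberY geo9Y bg9Y)
open B9PinGeometryKLevelV1 (unitDistY inΛY c35Y)
open B6Ineq2142KLevelV1 (β)
open B7Prop2SpecialUnitary (specialUnitaryUnits)
open Node00 (BlkY opsYOfLetters LettersY ExpsY Stage3Params)
open scoped Matrix.Norms.L2Operator

/-- ★ **ROW 24 AT def-Y's INSTANCE `opsYOfLetters N θ M⋆ 𝔏 𝔈`** (the certificate binder `t315` verbatim at the record's carriers
𝔸 = `Matrix (Fin N) (Fin N) ℂ`, G = SU(N)): `thm315_layerOfLetters_of_blocks` specialised. [cite: Balaban1985BackgroundPropagators, Thm 3.15 (3.185)–(3.187) p.432] -/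
theorem thm315_opsYOfLetters_of_blocks (N : ℕ) (θ : Stage3Params) (Mstar : ℕ) (𝔏 : LettersY N θ Mstar) (𝔈 : ExpsY N θ Mstar)
    (E S F : ∀ x : MemberY θ.d₆ θ.ℓ₆ θ.hd' θ.hL' θ.b₀ θ.b₁ Mstar,
      (bg9Y (Matrix (Fin N) (Fin N) ℂ) (specialUnitaryUnits (Fin N)) x).Cfg →
        Matrix (BlkY x.toKIdx) (BlkY x.toKIdx) (Matrix (Fin N) (Fin N) ℂ →L[ℂ] Matrix (Fin N) (Fin N) ℂ))
    {r m a₀ δ₁ B₁ : ℝ} (hm : 0 < m) (ha₀ : 0 < a₀) (hδ₁ : 0 < δ₁) (hB₁ : 0 < B₁)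
    (hrange : ∀ (x : MemberY θ.d₆ θ.ℓ₆ θ.hd' θ.hL' θ.b₀ θ.b₁ Mstar) (U : (bg9Y (Matrix (Fin N) (Fin N) ℂ) (specialUnitaryUnits (Fin N)) x).Cfg)
      (s s' : BlkY x.toKIdx), E x U s s' ≠ 0 → blockDistY x s s' ≤ r)
    (hrow : ∀ (x : MemberY θ.d₆ θ.ℓ₆ θ.hd' θ.hL' θ.b₀ θ.b₁ Mstar) (U : (bg9Y (Matrix (Fin N) (Fin N) ℂ) (specialUnitaryUnits (Fin N)) x).Cfg)
      (s : BlkY x.toKIdx), ∑ s', ‖E x U s s'‖ ≤ m)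
    (hadj : ∀ (x : MemberY θ.d₆ θ.ℓ₆ θ.hd' θ.hL' θ.b₀ θ.b₁ Mstar) (U : (bg9Y (Matrix (Fin N) (Fin N) ℂ) (specialUnitaryUnits (Fin N)) x).Cfg)
      (s' s : BlkY x.toKIdx), ‖F x U s' s‖ ≤ ‖E x U s s'‖)
    (h : ∀ (x : MemberY θ.d₆ θ.ℓ₆ θ.hd' θ.hL' θ.b₀ θ.b₁ Mstar) (α₀ : ℝ), 0 < α₀ → (geo9Y x).M * α₀ ≤ a₀ →
      ∀ U : (bg9Y (Matrix (Fin N) (Fin N) ℂ) (specialUnitaryUnits (Fin N)) x).Cfg,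
        (bg9Y (Matrix (Fin N) (Fin N) ℂ) (specialUnitaryUnits (Fin N)) x).Reg335 c35Y α₀ U →
        (bg9Y (Matrix (Fin N) (Fin N) ℂ) (specialUnitaryUnits (Fin N)) x).Reg336 c35Y α₀ U →
          GivenBy3185B (ops315BOfLetters x (𝔏 x) (E x) (S x) (F x)) U ∧
            HasRWExpCB (ops315BOfLetters x (𝔏 x) (E x) (S x) (F x)) (blockDistY x) B₁ U δ₁)
    (hG : ∀ (x : MemberY θ.d₆ θ.ℓ₆ θ.hd' θ.hL' θ.b₀ θ.b₁ Mstar) (U : (bg9Y (Matrix (Fin N) (Fin N) ℂ) (specialUnitaryUnits (Fin N)) x).Cfg),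
      GivenBy3185B (ops315BOfLetters x (𝔏 x) (E x) (S x) (F x)) U → ((opsYOfLetters N θ Mstar 𝔏 𝔈) x).GivenBy3185 U)
    (hH : ∀ (x : MemberY θ.d₆ θ.ℓ₆ θ.hd' θ.hL' θ.b₀ θ.b₁ Mstar) (U : (bg9Y (Matrix (Fin N) (Fin N) ℂ) (specialUnitaryUnits (Fin N)) x).Cfg)
      (δ' : ℝ), HasRWExpCB (ops315BOfLetters x (𝔏 x) (E x) (S x) (F x)) (blockDistY x) B₁ U δ' →
        ((opsYOfLetters N θ Mstar 𝔏 𝔈) x).HasRWExpC U δ') :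
    B9.Thm315FullPrinted c35Y geo9Y (bg9Y (Matrix (Fin N) (Fin N) ℂ) (specialUnitaryUnits (Fin N)))
      (fun x => ((opsYOfLetters N θ Mstar 𝔏 𝔈) x).Ck) inΛY unitDistY (fun x => ((opsYOfLetters N θ Mstar 𝔏 𝔈) x).GivenBy3185)
      (fun x => ((opsYOfLetters N θ Mstar 𝔏 𝔈) x).HasRWExpC) :=
  thm315_layerOfLetters_of_blocks 𝔏 𝔈 E S F hm ha₀ hδ₁ hB₁ hrange hrow hadj h hG hH

end Record

end Literature.MathematicalPhysics.QuantumFieldTheory.Balaban1983to89.B9Thm315WholeBlocks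

end
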